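import Summits.Parity.GeneralizedHardyLittlewood.Theses.LiouvilleShiftedTables

/-!
# drefute notes for line `positivity-quarantine` (crux `DilatedTableChowla`, stmt-Parity-14271)

Kernel-checked facts used in the stub audit (refuter-drefute-stmt-Parity-14271-0):

* `crux_imp_genericAffineTable : DilatedTableChowla → GenericAffineTable` — the hardest stub (C⁺)
  is IMPLIED by the crux (Markov at exponent `2C+1`, `E' = {q : x²/(log x)^C < q⁴F_q}`, any `B`,
  `κ = 1`; the one-point hypothesis is not even used).  Together with the skeleton's sorry-free
  `lhs_bound_of` ((Z1) ∧ (Z2) ∧ (★) ∧ (C⁺) ⟹ crux) and the truth of (Z1), (Z2), (★) (classical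
  theorems), (C⁺) is EQUIVALENT to the crux: no stub-level refutation of (C⁺) exists short of
  `¬ DilatedTableChowla` itself (cdisprove's remit), and closing (C⁺) is closing the crux.
* `onePointData_zero_vacuous`, `boxZeroFree_zero` — the `n = 0` instances of the interface
  predicates are vacuous (the `[NeZero n]` binder), so `q ∣ 0` creates no junk obligation.

The §0–§2 definitions are copied VERBATIM from `Lines/positivity-quarantine.lean` (work files under
`Cruxes/` are not importable).
-/

noncomputable section

namespace Summit.Parity.GeneralizedHardyLittlewood.Cruxes.DilatedTableChowla.DrefuteNotes

open Summit.Parity.GeneralizedHardyLittlewood.Theses.LiouvilleShiftedTables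
open Finset
open scoped Classical

/-! ### §0 (verbatim skeleton §0) -/

def L (n : ℤ) : ℝ := (ArithmeticFunction.liouville (Int.toNat n) : ℝ)

def rows (A : ℝ) (q u : ℕ) : Finset ℕ :=
  (Finset.Ioc ⌊A⌋₊ ⌊2 * A⌋₊).filter (fun a : ℕ => a ≡ u [MOD q])

def cols (x A : ℝ) (q v : ℕ) : Finset ℕ :=
  (Finset.Icc 1 ⌊x / A⌋₊).filter (fun b : ℕ => b ≡ v [MOD q])

def S (c : ℤ) (x A : ℝ) (q v a a' : ℕ) : ℝ :=
  ∑ b ∈ cols x A q v, L ((a : ℤ) * b + c) * L ((a' : ℤ) * b + c)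

def F (c : ℤ) (x A : ℝ) (q u v : ℕ) : ℝ :=
  ∑ a ∈ rows A q u, ∑ a' ∈ rows A q u, (S c x A q v a a') ^ 2

def lhs (c : ℤ) (δ x A : ℝ) (u v : ℕ → ℕ) : ℝ :=
  ∑ q ∈ Finset.Icc 1 ⌊x ^ (δ / 2)⌋₊, (q : ℝ) ^ 3 * F c x A q (u q) (v q)

theorem crux_iff_lhs : DilatedTableChowla ↔
    ∀ c : ℤ, c ≠ 0 → ∀ δ : ℝ, 0 < δ → δ ≤ 1 / 12 → ∀ C : ℝ, 0 < C → ∃ x₀ : ℝ, ∀ x : ℝ, x₀ ≤ x →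
      ∀ A : ℝ, x ^ δ ≤ A → A ≤ x ^ (1 / 3 + δ) → ∀ u v : ℕ → ℕ,
        lhs c δ x A u v ≤ x ^ 2 / Real.log x ^ C :=
  Iff.rfl

theorem F_nonneg (c : ℤ) (x A : ℝ) (q u v : ℕ) : 0 ≤ F c x A q u v :=
  Finset.sum_nonneg fun _ _ => Finset.sum_nonneg fun _ _ => sq_nonneg _

theorem term_nonneg (c : ℤ) (x A : ℝ) (q u v : ℕ) : 0 ≤ (q : ℝ) ^ 3 * F c x A q u v :=
  mul_nonneg (by positivity) (F_nonneg c x A q u v)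

/-! ### §1–§2 (verbatim skeleton): the interface predicates and (C⁺) -/

def boxEdge (x K' : ℝ) : ℝ := 1 - K' * Real.log (Real.log x) / Real.log x

def BoxZeroFree (n : ℕ) (x K' H : ℝ) : Prop :=
  ∀ [NeZero n], ∀ χ : DirichletCharacter ℂ n, ∀ s : ℂ,
    boxEdge x K' < s.re → |s.im| ≤ H → s ≠ 1 → DirichletCharacter.LFunction χ s ≠ 0

def OnePointData (q : ℕ) (x B κ : ℝ) : Prop :=
  ∀ n : ℕ, q ∣ n → (n : ℝ) ≤ q * Real.log x ^ κ → ∀ [NeZero n], ∀ χ : DirichletCharacter ℂ n,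
    ∀ y : ℝ, x ^ (1 / 2 : ℝ) ≤ y → y ≤ x ^ 2 →
      ‖∑ k ∈ Finset.Icc 1 ⌊y⌋₊, (ArithmeticFunction.liouville k : ℂ) * χ (k : ZMod n)‖ ≤
        y / Real.log x ^ B

def GenericAffineTable : Prop :=
  ∀ c : ℤ, c ≠ 0 → ∀ δ : ℝ, 0 < δ → δ ≤ 1 / 12 → ∀ C : ℝ, 0 < C → ∃ B κ : ℝ, 0 < κ ∧
    ∃ x₀ : ℝ, ∀ x : ℝ, x₀ ≤ x → ∀ A : ℝ, x ^ δ ≤ A → A ≤ x ^ (1 / 3 + δ) → ∀ u v : ℕ → ℕ,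
      ∃ E' : Finset ℕ, (∑ q ∈ E', ((q : ℝ))⁻¹) ≤ (Real.log x ^ C)⁻¹ ∧
        ∀ q : ℕ, 1 ≤ q → q ≤ ⌊x ^ (δ / 2)⌋₊ → q ∉ E' → OnePointData q x B κ →
          (q : ℝ) ^ 4 *
            (∑ a ∈ (Finset.Ioc ⌊A⌋₊ ⌊2 * A⌋₊).filter (fun a : ℕ => a ≡ u q [MOD q]),
              ∑ a' ∈ (Finset.Ioc ⌊A⌋₊ ⌊2 * A⌋₊).filter (fun a' : ℕ => a' ≡ u q [MOD q]),
                (∑ b ∈ (Finset.Icc 1 ⌊x / A⌋₊).filter (fun b : ℕ => b ≡ v q [MOD q]),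
                  (ArithmeticFunction.liouville (Int.toNat ((a : ℤ) * b + c)) : ℝ) *
                    (ArithmeticFunction.liouville (Int.toNat ((a' : ℤ) * b + c)) : ℝ)) ^ 2)
            ≤ x ^ 2 / Real.log x ^ C

theorem genericAffineTable_iff : GenericAffineTable ↔
    ∀ c : ℤ, c ≠ 0 → ∀ δ : ℝ, 0 < δ → δ ≤ 1 / 12 → ∀ C : ℝ, 0 < C → ∃ B κ : ℝ, 0 < κ ∧
      ∃ x₀ : ℝ, ∀ x : ℝ, x₀ ≤ x → ∀ A : ℝ, x ^ δ ≤ A → A ≤ x ^ (1 / 3 + δ) → ∀ u v : ℕ → ℕ,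
        ∃ E' : Finset ℕ, (∑ q ∈ E', ((q : ℝ))⁻¹) ≤ (Real.log x ^ C)⁻¹ ∧
          ∀ q : ℕ, 1 ≤ q → q ≤ ⌊x ^ (δ / 2)⌋₊ → q ∉ E' → OnePointData q x B κ →
            (q : ℝ) ^ 4 * F c x A q (u q) (v q) ≤ x ^ 2 / Real.log x ^ C :=
  Iff.rfl

/-! ### §3 Degenerate instances: `n = 0` is vacuous (no junk from `q ∣ 0`) -/

theorem boxZeroFree_zero (x K' H : ℝ) : BoxZeroFree 0 x K' H := by
  intro h; exact absurd rfl h.out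

/-- The `n = 0` clause of `OnePointData` (reachable since `q ∣ 0`) is vacuous. -/
theorem onePointData_zero_vacuous (x B : ℝ) :
    ∀ [NeZero (0 : ℕ)], ∀ χ : DirichletCharacter ℂ 0, ∀ y : ℝ, x ^ (1 / 2 : ℝ) ≤ y → y ≤ x ^ 2 →
      ‖∑ k ∈ Finset.Icc 1 ⌊y⌋₊, (ArithmeticFunction.liouville k : ℂ) * χ (k : ZMod 0)‖ ≤
        y / Real.log x ^ B := by
  intro h; exact absurd rfl h.out

/-! ### §4 (C⁺) is crux-implied: Markov at exponent `2C + 1` -/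

/-- MUTATION / COSTUME CHECK for the hardest stub: `DilatedTableChowla → GenericAffineTable`.
Given the crux at exponent `2C+1`, take `B = 0`, `κ = 1`, `x ≥ max x₀ 3` and
`E' := {q ≤ ⌊x^{δ/2}⌋ : x²/(log x)^C < q⁴ F_q}`; then `(x²/(log x)^C)·Σ_{E'} 1/q ≤ lhs ≤ x²/(log x)^{2C+1}`,
so `Σ_{E'} 1/q ≤ (log x)^{-(C+1)} ≤ (log x)^{-C}`, and off `E'` the pointwise bound holds by
definition — the `OnePointData` hypothesis is never used.  Hence (C⁺) is not a strict weakening of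
anything: modulo the three classical stubs it is EQUIVALENT to the crux. -/
theorem crux_imp_genericAffineTable (h : DilatedTableChowla) : GenericAffineTable := by
  rw [genericAffineTable_iff]
  rw [crux_iff_lhs] at h
  intro c hc δ hδ hδ' C hC
  refine ⟨0, 1, one_pos, ?_⟩
  obtain ⟨x₀, hx₀⟩ := h c hc δ hδ hδ' (2 * C + 1) (by linarith)
  refine ⟨max x₀ 3, fun x hx A hA1 hA2 u v => ?_⟩
  have hx0 : x₀ ≤ x := le_trans (le_max_left _ _) hx
  have hx3 : (3 : ℝ) ≤ x := le_trans (le_max_right _ _) hx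
  have hlog1 : 1 < Real.log x := by
    rw [Real.lt_log_iff_exp_lt (by linarith)]
    exact lt_of_lt_of_le (lt_trans Real.exp_one_lt_d9 (by norm_num)) hx3
  have hlog : 0 < Real.log x := by linarith
  have hR : 0 < x ^ 2 / Real.log x ^ C := div_pos (by positivity) (Real.rpow_pos_of_pos hlog C)
  set R : ℝ := x ^ 2 / Real.log x ^ C with hRdef
  set E' := (Finset.Icc 1 ⌊x ^ (δ / 2)⌋₊).filter
    (fun q : ℕ => R < (q : ℝ) ^ 4 * F c x A q (u q) (v q)) with hE'
  have key := hx₀ x hx0 A hA1 hA2 u v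
  refine ⟨E', ?_, ?_⟩
  · -- harmonic mass of `E'`
    have hsum : R * ∑ q ∈ E', ((q : ℝ))⁻¹ ≤ lhs c δ x A u v := by
      rw [Finset.mul_sum]
      unfold lhs
      calc ∑ q ∈ E', R * ((q : ℝ))⁻¹ ≤ ∑ q ∈ E', (q : ℝ) ^ 3 * F c x A q (u q) (v q) := by
            refine Finset.sum_le_sum fun q hq => ?_
            obtain ⟨hq, hqR⟩ := Finset.mem_filter.1 hq
            obtain ⟨hq1, -⟩ := Finset.mem_Icc.1 hq
            have hqpos : (0 : ℝ) < q := by exact_mod_cast hq1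
            have : (q : ℝ) ^ 3 * F c x A q (u q) (v q) =
                ((q : ℝ))⁻¹ * ((q : ℝ) ^ 4 * F c x A q (u q) (v q)) := by
              field_simp
            rw [this, mul_comm R]
            gcongr
        _ ≤ ∑ q ∈ Finset.Icc 1 ⌊x ^ (δ / 2)⌋₊, (q : ℝ) ^ 3 * F c x A q (u q) (v q) :=
            Finset.sum_le_sum_of_subset_of_nonneg (Finset.filter_subset _ _)
              fun q _ _ => term_nonneg c x A q (u q) (v q)
    have h1 : R * ∑ q ∈ E', ((q : ℝ))⁻¹ ≤ x ^ 2 / Real.log x ^ (2 * C + 1) := hsum.trans key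
    -- `x² / (log x)^{2C+1} = R · (log x)^{-(C+1)}`
    have hsplit : x ^ 2 / Real.log x ^ (2 * C + 1) = R * (Real.log x ^ (C + 1))⁻¹ := by
      have : Real.log x ^ (2 * C + 1) = Real.log x ^ C * Real.log x ^ (C + 1) := by
        rw [← Real.rpow_add hlog]; ring_nf
      rw [this, hRdef]
      field_simp
    rw [hsplit] at h1
    have h2 : ∑ q ∈ E', ((q : ℝ))⁻¹ ≤ (Real.log x ^ (C + 1))⁻¹ := le_of_mul_le_mul_left h1 hR
    refine h2.trans ?_
    rw [inv_le_inv₀ (Real.rpow_pos_of_pos hlog _) (Real.rpow_pos_of_pos hlog _)]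
    exact Real.rpow_le_rpow_of_exponent_le hlog1.le (by linarith)
  · intro q hq1 hqQ hqE _hOne
    by_contra hlt
    exact hqE (Finset.mem_filter.2 ⟨Finset.mem_Icc.2 ⟨hq1, hqQ⟩, not_le.mp hlt⟩)

/-! ### §5 Degenerate parameter corners hold (no falsity hides in `K' ≤ 0` or `B ≤ 0`) -/

/-- For `K' ≤ 0` and `x ≥ e` the Linnik box lies in `re s ≥ 1`, where no `L(s,χ)` vanishes
(`s ≠ 1`, Mathlib `LFunction_ne_zero_of_one_le_re`): every modulus is box-zero-free.  So (Z1), (Z2)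
and the hypothesis side of (★) are trivially consistent in that corner. -/
theorem boxZeroFree_of_nonpos {K' x : ℝ} (hK' : K' ≤ 0) (hx : Real.exp 1 ≤ x) (n : ℕ) (H : ℝ) :
    BoxZeroFree n x K' H := by
  intro _ χ s hre _him hs1
  have hxpos : 0 < x := lt_of_lt_of_le (Real.exp_pos 1) hx
  have hlog : 1 ≤ Real.log x := by
    rw [Real.le_log_iff_exp_le hxpos]; exact hx
  have hll : 0 ≤ Real.log (Real.log x) := Real.log_nonneg hlog
  have hterm : K' * Real.log (Real.log x) / Real.log x ≤ 0 :=
    div_nonpos_of_nonpos_of_nonneg (mul_nonpos_of_nonpos_of_nonneg hK' hll) (by linarith)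
  have hedge : 1 ≤ boxEdge x K' := by unfold boxEdge; linarith
  exact DirichletCharacter.LFunction_ne_zero_of_one_le_re χ (Or.inr hs1) (by linarith)

/-- (Z1) at `K' ≤ 0` (with `x₀ = e`). -/
theorem smallConductorsZeroFree_of_nonpos {K' : ℝ} (hK' : K' ≤ 0) (K K'' : ℝ) :
    ∃ x₀ : ℝ, ∀ x : ℝ, x₀ ≤ x →
      ∀ d : ℕ, 1 ≤ d → (d : ℝ) ≤ Real.log x ^ K → BoxZeroFree d x K' (Real.log x ^ K'') :=
  ⟨Real.exp 1, fun _ hx d _ _ => boxZeroFree_of_nonpos hK' hx d _⟩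

/-- (Z2) at `K' ≤ 0`: `S = ∅`, `E₀ = 0`, `x₀ = e`. -/
theorem fewBadConductors_of_nonpos {K' : ℝ} (hK' : K' ≤ 0) (θ K'' : ℝ) :
    ∃ E₀ x₀ : ℝ, ∀ x : ℝ, x₀ ≤ x →
      ∃ S : Finset ℕ, (S.card : ℝ) ≤ Real.log x ^ E₀ ∧
        (∀ s ∈ S, ¬ BoxZeroFree s x K' (Real.log x ^ K'')) ∧
        ∀ d : ℕ, 1 ≤ d → (d : ℝ) ≤ x ^ θ → ¬ BoxZeroFree d x K' (Real.log x ^ K'') →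
          ∃ s ∈ S, s ∣ d := by
  refine ⟨0, Real.exp 1, fun x hx => ⟨∅, by simp, by simp, fun d _ _ hbad => ?_⟩⟩
  exact (hbad (boxZeroFree_of_nonpos hK' hx d _)).elim

/-- (★)'s conclusion at `B ≤ 0` is the trivial bound: `OnePointData q x B κ` for every `x ≥ e`
(uses only `|λ| ≤ 1`, `‖χ‖ ≤ 1`, `⌊y⌋ ≤ y` and `(log x)^B ≤ 1`). -/
theorem onePointData_of_nonpos {B : ℝ} (hB : B ≤ 0) {x : ℝ} (hx : Real.exp 1 ≤ x) (q : ℕ)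
    (κ : ℝ) : OnePointData q x B κ := by
  intro n _ _ _ χ y hy1 _
  have hxpos : 0 < x := lt_of_lt_of_le (Real.exp_pos 1) hx
  have hlog : 1 ≤ Real.log x := by rw [Real.le_log_iff_exp_le hxpos]; exact hx
  have hy0 : 0 ≤ y := le_trans (Real.rpow_nonneg hxpos.le _) hy1
  have hpow : Real.log x ^ B ≤ 1 := Real.rpow_le_one_of_one_le_of_nonpos hlog hB
  have hpowpos : 0 < Real.log x ^ B := Real.rpow_pos_of_pos (by linarith) B
  calc ‖∑ k ∈ Finset.Icc 1 ⌊y⌋₊, (ArithmeticFunction.liouville k : ℂ) * χ (k : ZMod n)‖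
      ≤ ∑ k ∈ Finset.Icc 1 ⌊y⌋₊, ‖(ArithmeticFunction.liouville k : ℂ) * χ (k : ZMod n)‖ :=
        norm_sum_le _ _
    _ ≤ ∑ k ∈ Finset.Icc 1 ⌊y⌋₊, (1 : ℝ) := by
        refine Finset.sum_le_sum fun k hk => ?_
        rw [norm_mul]
        have h1 : ‖(ArithmeticFunction.liouville k : ℂ)‖ ≤ 1 := by
          have hk0 : k ≠ 0 := by have := (Finset.mem_Icc.1 hk).1; omega
          rw [ArithmeticFunction.liouville_apply hk0]
          push_cast
          simp
        have h2 : ‖χ (k : ZMod n)‖ ≤ 1 := DirichletCharacter.norm_le_one χ _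
        exact mul_le_one₀ h1 (norm_nonneg _) h2
    _ = ⌊y⌋₊ := by simp
    _ ≤ y := Nat.floor_le hy0
    _ ≤ y / Real.log x ^ B := by
        rw [le_div_iff₀ hpowpos]
        exact mul_le_of_le_one_right hy0 hpow

end Summit.Parity.GeneralizedHardyLittlewood.Cruxes.DilatedTableChowla.DrefuteNotes
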